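import Mathlib.FieldTheory.Galois.Infinite
import Literature.AnabelianGeometry.EtaleTheta.KummerMapExactness
import Summits.ABC.IUTFork.LanaKummerAmbient
import HarnessLib

/-!
# L-LANA objects XII sexies: the Kummer TOWER `κ : Ω^× → ∞H¹(Π, Λ(Ω^×))` through `ρ : Π → Gal(Ω/k)` — and its injectivity on ALL of `Ω^×`

Record-only file (D-0012) of the abc-iut cell (seat abc-iut-c312-4, L-LANA level, plan/LLANA-SPEC N13 "colimit over
`H`" and N14 Step 6); TAKES NO SIDE on [IUTchIII] Cor. 3.12. LANA §6.1 pp. 31–32: "Let `H` vary over an inductive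
system of (open) subgroups of `G` … (c) one has `M = ⋃_H M^H` … Taking colimits in `H`, we obtain
`κ : M → lim_{→ H} H¹(H, Λ(M))`", "`∞H^i(G, A) := lim_J H^i(G|_J, A)`"; §6.2 (g) p. 35: "`κ_t : O^▷_{v,t} →
∞H¹(D_t, Λ_{v,t})` is the local Kummer map", `D_t ⊆ Π_{v,Ÿ}` a decomposition group acting on `K̄_v` THROUGH
`Π_v ↠ G_v`. The sibling `LanaKummerTower.lean` (gen 2) built the tower over the constructed closure `AlgCl K_v`
for `G_v` itself; `LanaKummerAmbient.lean` (gen 3) moved the FULL-LEVEL embedding to an ambient Galois closure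
`Ω/k` and an arbitrary `ρ : Π → Gal(Ω/k)`. THIS file is the tower in that generality (Mathlib + L2-t3 only):

* `GalLevel k Ω` — the open normal subgroups `U ⊴ Gal(Ω/k)` (directed by reverse inclusion), and the induced
  system on `Π`: `levelVia ρ U := ρ⁻¹(U)` (open normal preimages; `(ρ⁻¹U)·ρ = ρ(Π) ∩ U`, `map_levelVia`);
* `exists_galLevel_fixing` / `isExhausted_viaUnits` — **hypothesis (c) "`M = ⋃_H M^H`" PROVED** for `M = Ω^×`
  and the system `ρ⁻¹(U)` (Krull topology: stabilisers are open, open normal subgroups are cofinal —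
  `stabilizer_isOpen_of_isIntegral`, `krullTopology_mem_nhds_one_iff_of_normal`, `InfiniteGalois.normal_iff_isGalois`);
* `H1Tower ρ := lim_{→ U} H¹(ρ⁻¹U, Λ(Ω^×))`, **`kummerTower ρ : Ω^× → ∞H¹`** (L2-t3 `kummerMapHom`), computing at
  each level as the level Kummer map (`kummerTower_apply_of_mem`);
* `levelField ρ U := Ω^{ρ(Π) ∩ U}` with **`(Ω^×)^{ρ⁻¹U} = (levelField)^×`** (`mem_invariants_levelVia_iff`, definitional),
  finite over `k` as soon as `ρ(Π)` is OPEN (`finiteDimensional_levelField`, `InfiniteGalois.isOpen_iff_finite`);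
* **`kummerTower_injective_of` — `κ` is injective on ALL of `Ω^×`** provided `ρ(Π)` is open in `Gal(Ω/k)` and every
  finite subextension `E/k` of `Ω` has `⋂_n (E^×)^n = 1` (the exactness of the directed colimit is gen-2's
  `Literature/…/KummerMapExactness.kummerMapHom_injective_of`; a dying class has `ρ⁻¹U`-invariant — i.e.
  `levelField`-rational — roots at some level).

The tempered-curve instances (`Π := Π^temp_{X_K}` and `Π := D_x`, `Ω := ℚ̄_p`, both hypotheses DISCHARGED by L3's
`isOpen_aug_decomp` / finiteness of `K` and L4's `divisibleElementsTrivial_units_of_finite_padic`) are the sibling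
`LanaKummerTemperedTower.lean`. Modelling notes as in `LanaKummerTower.lean`: discrete Mathlib `H¹`; the index
system `ρ⁻¹(U)` is cofinal among open subgroups of `Π` only when `ker ρ` is trivial (e.g. `Π = D_x` at a
non-cusp) — for `Π = Π^temp` it is the sub-system of open subgroups CONTAINING `Δ^temp` (LANA's `J` ranges over all
finite-index open subgroups; the comparison map to that larger colimit is not constructed here).
[cite: LANA2026Report, §6.1 pp. 31–32, §6.2 (g) p. 35, §4.2 (b) p. 26] NOT here: any judgement.
-/

noncomputable section

namespace Summit.ABC
namespace IUTFork
namespace Ambient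

open Literature.AnabelianGeometry.EtaleTheta
open Literature.AnabelianGeometry.AbsoluteAnabelian.AbsTopIII (DivisibleElementsTrivial)
open scoped Topology

/-! ## 1. The inductive system: open normal subgroups of `Gal(Ω/k)` and their preimages in `Π` -/

section Levels

variable (k Ω : Type) [Field k] [Field Ω] [Algebra k Ω]

/-- **The inductive system of §6.1 on `Gal(Ω/k)`**: its open normal subgroups (Krull topology).
[cite: LANA2026Report, §6.1 p. 31] -/
def GalLevel : Type := {U : OpenSubgroup (Ω ≃ₐ[k] Ω) // (U : Subgroup (Ω ≃ₐ[k] Ω)).Normal}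

namespace GalLevel

variable {k Ω}

/-- The subgroup `U ≤ Gal(Ω/k)` of a level. [cite: LANA2026Report, §6.1 p. 31] -/
def toSubgroup (i : GalLevel k Ω) : Subgroup (Ω ≃ₐ[k] Ω) := (i.1 : Subgroup (Ω ≃ₐ[k] Ω))

/-- Each level is normal. [cite: LANA2026Report, §6.1 p. 31] -/
instance normal (i : GalLevel k Ω) : i.toSubgroup.Normal := i.2

/-- Each level is open. [cite: LANA2026Report, §6.1 p. 31] -/
theorem isOpen (i : GalLevel k Ω) : IsOpen (i.toSubgroup : Set (Ω ≃ₐ[k] Ω)) := i.1.isOpen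

/-- The order of the system: `U ≤ U'` iff `U' ⊆ U` (restriction maps go along it). [cite: LANA2026Report, §6.1 p. 31] -/
instance instPreorder : Preorder (GalLevel k Ω) where
  le i j := j.toSubgroup ≤ i.toSubgroup
  le_refl _ := le_rfl
  le_trans _ _ _ hij hjk := hjk.trans hij

/-- `U ≤ U'` iff `U' ⊆ U`. [cite: LANA2026Report, §6.1 p. 31] -/
theorem le_def (i j : GalLevel k Ω) : i ≤ j ↔ j.toSubgroup ≤ i.toSubgroup := Iff.rfl

/-- Classical decidable equality (Mathlib's direct limit wants it). [folklore] -/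
instance instDecidableEq : DecidableEq (GalLevel k Ω) := Classical.decEq _

/-- The meet of two levels. [folklore] -/
def inf (i j : GalLevel k Ω) : GalLevel k Ω :=
  ⟨i.1 ⊓ j.1, by
    change ((i.1 : Subgroup (Ω ≃ₐ[k] Ω)) ⊓ (j.1 : Subgroup (Ω ≃ₐ[k] Ω))).Normal
    haveI := i.2; haveI := j.2
    infer_instance⟩

/-- `(U ∩ U').toSubgroup = U ⊓ U'`. [folklore] -/
theorem toSubgroup_inf (i j : GalLevel k Ω) : (inf i j).toSubgroup = i.toSubgroup ⊓ j.toSubgroup := rfl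

/-- The system is directed. [cite: LANA2026Report, §6.1 p. 31] -/
instance instIsDirectedOrder : IsDirectedOrder (GalLevel k Ω) :=
  ⟨fun i j => ⟨inf i j, by rw [le_def, toSubgroup_inf]; exact inf_le_left,
    by rw [le_def, toSubgroup_inf]; exact inf_le_right⟩⟩

/-- The level `Gal(Ω/k)` itself. [cite: LANA2026Report, §6.1 p. 31] -/
def top : GalLevel k Ω := ⟨⊤, by change (⊤ : Subgroup (Ω ≃ₐ[k] Ω)).Normal; infer_instance⟩

/-- `top.toSubgroup = ⊤`. [folklore] -/
@[simp] theorem toSubgroup_top : (top : GalLevel k Ω).toSubgroup = ⊤ := rfl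

/-- `top` is the least level. [folklore] -/
theorem top_le (i : GalLevel k Ω) : top ≤ i := by
  rw [le_def, toSubgroup_top]; exact le_top

end GalLevel

variable {k Ω} {P : Type} [Group P] (ρ : P →* (Ω ≃ₐ[k] Ω))

/-- **The induced system on `Π`: `U ↦ ρ⁻¹(U)`** (for `Π = D_t ↪ G_v`: the open subgroups `D_t ∩ U` — LANA's
"`∞H¹(D_t, –)`"). [cite: LANA2026Report, §6.2 (g) p. 35, §6.1 p. 32] -/
def levelVia : GalLevel k Ω → Subgroup P := fun i => i.toSubgroup.comap ρ

/-- Membership: `g ∈ ρ⁻¹(U) ⟺ ρ g ∈ U`. [folklore] -/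
theorem mem_levelVia_iff (i : GalLevel k Ω) (g : P) : g ∈ levelVia ρ i ↔ ρ g ∈ i.toSubgroup := Iff.rfl

/-- The family `ρ⁻¹(U)` is antitone along the system. [cite: LANA2026Report, §6.1 p. 31] -/
theorem levelVia_anti : ∀ ⦃i j : GalLevel k Ω⦄, i ≤ j → levelVia ρ j ≤ levelVia ρ i :=
  fun _ _ h => Subgroup.comap_mono h

/-- Each `ρ⁻¹(U)` is normal in `Π`. [folklore] -/
instance levelVia_normal (i : GalLevel k Ω) : (levelVia ρ i).Normal := by
  unfold levelVia; infer_instance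

/-- `ρ⁻¹(Gal) = Π`. [folklore] -/
@[simp] theorem levelVia_top : levelVia ρ GalLevel.top = ⊤ := Subgroup.comap_top ρ

/-- `ρ(ρ⁻¹(U)) = ρ(Π) ∩ U`. [folklore] -/
theorem map_levelVia (i : GalLevel k Ω) : (levelVia ρ i).map ρ = ρ.range ⊓ i.toSubgroup :=
  Subgroup.map_comap_eq ρ _

end Levels

/-! ## 2. `∞H¹ := lim_{→ U} H¹(ρ⁻¹U, Λ(Ω^×))`, hypothesis (c), and the tower `κ` -/

section Tower

variable {k Ω : Type} [Field k] [Field Ω] [Algebra k Ω] [IsAlgClosed Ω]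
variable {P : Type} [Group P] (ρ : P →* (Ω ≃ₐ[k] Ω))

/-- **`∞H¹(Π, Λ(Ω^×)) := lim_{→ U} H¹(ρ⁻¹U, Λ(Ω^×))`** (L2-t3 `H1Colimit`). [cite: LANA2026Report, §6.1 p. 32] -/
abbrev H1Tower : Type := H1Colimit (ViaUnits ρ) (levelVia ρ) (levelVia_anti ρ)

/-- The structure map `H¹(ρ⁻¹U, Λ) → ∞H¹`. [cite: LANA2026Report, §6.1 p. 31] -/
abbrev toTower (i : GalLevel k Ω) :
    groupCohomology.H1 (cyclotomeRep (A := ViaUnits ρ) (levelVia ρ i)) →+ H1Tower ρ :=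
  toColimit (A := ViaUnits ρ) (levelVia ρ) (levelVia_anti ρ) i

variable [IsGalois k Ω]

omit [IsAlgClosed Ω] in
/-- Every `a ∈ Ω` is fixed by some open NORMAL subgroup of `Gal(Ω/k)`: its stabiliser is Krull-open, hence contains
`Gal(Ω/E)` for a finite normal — so Galois — `E/k`, which is a normal subgroup. (Gen-2's `exists_level_fixing`,
generalised from `AlgCl K_v` to any Galois `Ω/k`.) [cite: LANA2026Report, §6.1 (c) p. 31] -/
theorem exists_galLevel_fixing (a : Ω) : ∃ i : GalLevel k Ω, ∀ σ ∈ i.toSubgroup, σ a = a := by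
  have hs : (MulAction.stabilizer (Ω ≃ₐ[k] Ω) a : Set (Ω ≃ₐ[k] Ω)) ∈ 𝓝 (1 : Ω ≃ₐ[k] Ω) :=
    (stabilizer_isOpen_of_isIntegral (K := k) a).mem_nhds (Subgroup.one_mem _)
  obtain ⟨E, hfd, hnorm, hsub⟩ := (krullTopology_mem_nhds_one_iff_of_normal k Ω _).mp hs
  haveI := hfd
  haveI := hnorm
  haveI : Algebra.IsSeparable k E := Algebra.isSeparable_tower_bot_of_isSeparable k E Ω
  haveI : IsGalois k E := {}
  refine ⟨⟨⟨E.fixingSubgroup, E.fixingSubgroup_isOpen⟩, ?_⟩, fun σ hσ => ?_⟩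
  · change E.fixingSubgroup.Normal
    exact (InfiniteGalois.normal_iff_isGalois E).mpr inferInstance
  · have hσ' : σ ∈ (MulAction.stabilizer (Ω ≃ₐ[k] Ω) a : Set (Ω ≃ₐ[k] Ω)) := hsub hσ
    exact hσ'

omit [IsAlgClosed Ω] in
/-- **Hypothesis (c) of §6.1 PROVED for `Ω^×` and the system `ρ⁻¹(U)`**: every unit is invariant under some
`ρ⁻¹(U)`. [cite: LANA2026Report, §6.1 (c) p. 31] -/
theorem isExhausted_viaUnits : IsExhausted (ViaUnits ρ) (levelVia ρ) := fun u => by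
  obtain ⟨i, hi⟩ := exists_galLevel_fixing (k := k) (((ViaUnits.of ρ).symm u : Ωˣ) : Ω)
  refine ⟨i, fun g => ?_⟩
  change ((g : P) • u : ViaUnits ρ) = u
  apply (ViaUnits.of ρ).symm.injective
  exact Units.ext (hi (ρ g) g.2)

/-- **The Kummer tower `κ : Ω^× → lim_{→ U} H¹(ρ⁻¹U, Λ(Ω^×))`** ("Taking colimits … we obtain `κ : M → lim H¹(H, Λ(M))`";
§6.2 (g): "`κ_t` … is the local Kummer map") — L2-t3's `kummerMapHom`, hypotheses (a) rootable and (c) exhausted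
DISCHARGED. [cite: LANA2026Report, §6.1 p. 31, §6.2 (g) p. 35] -/
def kummerTower : Additive (ViaUnits ρ) →+ H1Tower ρ :=
  kummerMapHom (levelVia_anti ρ) (isExhausted_viaUnits ρ)

/-- `κ` computes at any level fixing `a` as the level Kummer map: `κ(a) = [κ_{ρ⁻¹U}(a)]`.
[cite: LANA2026Report, §6.1 p. 31] -/
theorem kummerTower_apply_of_mem (i : GalLevel k Ω) (a : invariants (A := ViaUnits ρ) (levelVia ρ i)) :
    kummerTower ρ (Additive.ofMul (a : ViaUnits ρ)) =
      toTower ρ i (kummerMapFixed (A := ViaUnits ρ) (levelVia ρ i) (Additive.ofMul a)) :=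
  kummerMapHom_apply_of_mem (levelVia_anti ρ) (isExhausted_viaUnits ρ) i a

/-- `κ(ab) = κ(a) + κ(b)`. [cite: LANA2026Report, §6.1 p. 31] -/
theorem kummerTower_mul (a b : ViaUnits ρ) :
    kummerTower ρ (Additive.ofMul (a * b)) = kummerTower ρ (Additive.ofMul a) + kummerTower ρ (Additive.ofMul b) :=
  map_add (kummerTower ρ) (Additive.ofMul a) (Additive.ofMul b)

end Tower

/-! ## 3. Invariants at a level are the units of a finite extension; injectivity of `κ` on all of `Ω^×` -/

section Injective

variable {k Ω : Type} [Field k] [Field Ω] [Algebra k Ω]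
variable {P : Type} [Group P] (ρ : P →* (Ω ≃ₐ[k] Ω))

/-- **The field of a level**: `Ω^{ρ(Π) ∩ U}`, the fixed field of `ρ(ρ⁻¹U)` (for `Π = D_t`, `U` small: a finite
extension of `K_{v,t}`). [cite: LANA2026Report, §6.2 (g) p. 35] -/
def levelField (i : GalLevel k Ω) : IntermediateField k Ω := IntermediateField.fixedField ((levelVia ρ i).map ρ)

/-- **`(Ω^×)^{ρ⁻¹U} = (Ω^{ρ(Π) ∩ U})^×`**: a unit is invariant under `ρ⁻¹(U)` iff it lies in the level field
(definitional: both say "fixed by every `ρ g`, `ρ g ∈ U`"). [cite: LANA2026Report, §6.1 p. 31] -/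
theorem mem_invariants_levelVia_iff (i : GalLevel k Ω) (u : ViaUnits ρ) :
    u ∈ invariants (A := ViaUnits ρ) (levelVia ρ i) ↔
      (((ViaUnits.of ρ).symm u : Ωˣ) : Ω) ∈ levelField ρ i := by
  rw [levelField, IntermediateField.mem_fixedField_iff, invariants, FixedPoints.mem_subgroup]
  constructor
  · rintro h σ ⟨g, hg, rfl⟩
    have h1 : ((⟨g, hg⟩ : levelVia ρ i) • u : ViaUnits ρ) = u := h ⟨g, hg⟩
    have h2 := congrArg (fun x : ViaUnits ρ => (((ViaUnits.of ρ).symm x : Ωˣ) : Ω)) h1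
    exact h2
  · intro h g
    change ((g : P) • u : ViaUnits ρ) = u
    apply (ViaUnits.of ρ).symm.injective
    exact Units.ext (h (ρ g) ⟨g, g.2, rfl⟩)

/-- `ρ(Π) ∩ U ≤ Gal(Ω/levelField)`. [folklore] -/
theorem map_levelVia_le_fixingSubgroup (i : GalLevel k Ω) :
    (levelVia ρ i).map ρ ≤ (levelField ρ i).fixingSubgroup :=
  (IntermediateField.le_iff_le _ _).mp le_rfl

variable [IsGalois k Ω]

/-- **The level fields are FINITE over `k` when `ρ(Π)` is open**: `Gal(Ω/levelField) ⊇ ρ(Π) ∩ U` is then open,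
and open fixing subgroups cut out finite extensions (`InfiniteGalois.isOpen_iff_finite`).
[cite: LANA2026Report, §6.2 (g) p. 35] -/
theorem finiteDimensional_levelField (hρ : IsOpen (ρ.range : Set (Ω ≃ₐ[k] Ω))) (i : GalLevel k Ω) :
    FiniteDimensional k ↥(levelField ρ i) := by
  refine (InfiniteGalois.isOpen_iff_finite (levelField ρ i)).mp ?_
  have hopen : IsOpen (((levelVia ρ i).map ρ : Subgroup (Ω ≃ₐ[k] Ω)) : Set (Ω ≃ₐ[k] Ω)) := by
    rw [map_levelVia, Subgroup.coe_inf]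
    exact hρ.inter i.isOpen
  exact Subgroup.isOpen_mono (map_levelVia_le_fixingSubgroup ρ i) hopen

variable [IsAlgClosed Ω]

/-- **`κ : Ω^× → ∞H¹` is INJECTIVE on all of `Ω^×`** when `ρ(Π)` is open and every finite subextension `E/k` of `Ω`
satisfies `⋂_n (E^×)^n = 1`: a class dying in the colimit dies at some level `ρ⁻¹U` (exactness of directed colimits,
gen-2 `KummerMapExactness`), i.e. its element has `ρ⁻¹U`-invariant compatible roots, which lie in the finite
extension `levelField`, forcing the element to be `1`. [cite: LANA2026Report, §6.1 p. 31, §6.2 (g) p. 36] -/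
theorem kummerTower_injective_of (hρ : IsOpen (ρ.range : Set (Ω ≃ₐ[k] Ω)))
    (hDET : ∀ E : IntermediateField k Ω, FiniteDimensional k ↥E → DivisibleElementsTrivial (↥E)ˣ) :
    Function.Injective (kummerTower ρ) := by
  unfold kummerTower
  refine kummerMapHom_injective_of (levelVia ρ) (levelVia_anti ρ) (isExhausted_viaUnits ρ) fun i a ha hroots => ?_
  have hE := hDET (levelField ρ i) (finiteDimensional_levelField ρ hρ i)
  -- the element and its roots, as units of the level field
  have hmem : (((ViaUnits.of ρ).symm a : Ωˣ) : Ω) ∈ levelField ρ i := (mem_invariants_levelVia_iff ρ i a).mp ha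
  have hne : (⟨_, hmem⟩ : ↥(levelField ρ i)) ≠ 0 := by
    intro h0
    exact ((ViaUnits.of ρ).symm a).ne_zero (congrArg (fun x : ↥(levelField ρ i) => (x : Ω)) h0)
  have hx : Units.mk0 _ hne = 1 := hE.eq_one_of_forall_exists_pow (Units.mk0 _ hne) fun n hn => by
    obtain ⟨b, hb, hbn⟩ := hroots ⟨n, hn⟩
    have hbmem : (((ViaUnits.of ρ).symm b : Ωˣ) : Ω) ∈ levelField ρ i :=
      (mem_invariants_levelVia_iff ρ i b).mp hb
    have hbne : (⟨_, hbmem⟩ : ↥(levelField ρ i)) ≠ 0 := by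
      intro h0
      exact ((ViaUnits.of ρ).symm b).ne_zero (congrArg (fun x : ↥(levelField ρ i) => (x : Ω)) h0)
    refine ⟨Units.mk0 _ hbne, Units.ext (Subtype.ext ?_)⟩
    have hbn' := congrArg (fun x : ViaUnits ρ => (((ViaUnits.of ρ).symm x : Ωˣ) : Ω)) hbn
    simpa using hbn'
  have hx' := congrArg (fun x : (↥(levelField ρ i))ˣ => ((x : ↥(levelField ρ i)) : Ω)) hx
  simp only [Units.val_mk0, Units.val_one, OneMemClass.coe_one] at hx'
  apply (ViaUnits.of ρ).symm.injective
  exact Units.ext hx'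

/-- Hence `κ(a) = 0 ⟺ a = 1` on all of `Ω^×`. [cite: LANA2026Report, §6.1 p. 31] -/
theorem kummerTower_eq_zero_iff_of (hρ : IsOpen (ρ.range : Set (Ω ≃ₐ[k] Ω)))
    (hDET : ∀ E : IntermediateField k Ω, FiniteDimensional k ↥E → DivisibleElementsTrivial (↥E)ˣ)
    (a : ViaUnits ρ) : kummerTower ρ (Additive.ofMul a) = 0 ↔ a = 1 := by
  constructor
  · intro h0
    exact Additive.ofMul.injective (kummerTower_injective_of ρ hρ hDET (by rw [h0, ofMul_one, map_zero]))
  · rintro rfl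
    exact map_zero (kummerTower ρ)

end Injective

end Ambient

end IUTFork

end Summit.ABC

end
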